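import Literature.AnabelianGeometry.AbsoluteAnabelian.DiagramCores

/-!
# Homotopies through fully faithful structure functors ([AbsTopIII] Def. 3.5 (ii)–(iv), toolkit I)

S. Mochizuki, *Topics in Absolute Anabelian Geometry III*, Def. 3.5 (ii)–(iv) pp. 75–76 (manuscript
`paper:url-5493eb38cbb7`, bib key `MochizukiAbsTopIII2015`).  `DiagramCores.lean` (seat
abc-iut-L4-t5) builds the CORE family of a diagram of categories whose functors lie over a fixed
category `𝒞` through "structure functors" `N_v : 𝒟_v ⥤ 𝒞` with isomorphisms `μ_e : 𝒟_e ⋙ N ≅ N`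
(`OverData`, `OverData.pathIso`).  Telecores and contact structures (Cor. 3.6 (ii) / 3.7 (ii) /
4.5 (ii) / 5.5 (ii)) need homotopies between co-verticial pairs of paths ending at OTHER vertices.
This file: if `N_w` is FULLY FAITHFUL, two co-verticial paths `[γ₁], [γ₂]` into `w` carry a unique
homotopy `𝒟_[γ₁] ⟶ 𝒟_[γ₂]` lying over `pathIso γ₁ ∘ pathIso γ₂⁻¹` (`OverData.lift`, uniqueness
`lift_ext`), functorial (`lift_self`, `lift_trans`) and compatible with pre- and post-composition of
paths (`lift_precomp_heq`, `lift_postcomp_heq`).  Also: nestedness of suffix decompositions of a path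
(`path_suffix_nested`), "the saturation is the smallest saturated set" (`Saturation.subset`), and the
restriction of a family of homotopies to a saturated subset of its boundary set
(`HomotopyFamily.restrictBoundary`).  The universal family built from these is in
`DiagramUniversalFamilies.lean`.  Pure category theory; no claim of the paper is asserted.
-/

namespace Literature.AnabelianGeometry.AbsoluteAnabelian

open _root_.CategoryTheory _root_.Quiver

universe v u w

/-! ### Paths: nested suffix decompositions; vertices without outgoing edges -/

/-- Two decompositions `[σ]∘[γ] = [σ']∘[γ']` of one path are NESTED: one of `σ`, `σ'` is a suffix of
the other (combinatorial bookkeeping for the boundary set of a telecore family, Def. 3.5 (iv) (b);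
the common-vertex case is seat abc-iut-L4-t12's `path_suffixes_nested`).
[cite: MochizukiAbsTopIII2015, Definition 3.5 (iv) p.76] -/
theorem path_suffix_nested {V : Type*} [Quiver V] {a o : V} :
    ∀ {b : V} (s : Path o b) {o' : V} (s' : Path o' b) (p : Path a o) (p' : Path a o'),
      p.comp s = p'.comp s' →
        (∃ t : Path o o', s = t.comp s') ∨ (∃ t : Path o' o, s' = t.comp s) := by
  intro b s
  induction s with
  | nil => intro o' s' p p' _; exact Or.inr ⟨s', (Path.comp_nil _).symm⟩
  | cons s e ih =>
    intro o' s' p p' h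
    cases s' with
    | nil => exact Or.inl ⟨s.cons e, (Path.comp_nil _).symm⟩
    | cons s' e' =>
      have h' : (p.comp s).cons e = (p'.comp s').cons e' := h
      obtain rfl := Path.obj_eq_of_cons_eq_cons h'
      obtain rfl := eq_of_heq (Path.hom_heq_of_cons_eq_cons h')
      rcases ih s' p p' (eq_of_heq (Path.heq_of_cons_eq_cons h')) with ⟨t, ht⟩ | ⟨t, ht⟩
      · exact Or.inl ⟨t, by rw [ht, Path.comp_cons]⟩
      · exact Or.inr ⟨t, by rw [ht, Path.comp_cons]⟩

/-- If a vertex `ω` has no outgoing edges — e.g. the observation vertex `v_𝒮` of an observable,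
Def. 3.5 (iii) (b) — every path starting at `ω` ends at `ω` (bookkeeping).
[cite: MochizukiAbsTopIII2015, Definition 3.5 (iii) p.75] -/
theorem eq_of_path_of_isEmpty_hom {V : Type*} [Quiver V] {ω : V} (hout : ∀ b : V, IsEmpty (ω ⟶ b)) :
    ∀ {b : V} (_ : Path ω b), b = ω
  | _, .nil => rfl
  | _, .cons r e => by
    obtain rfl := eq_of_path_of_isEmpty_hom hout r
    exact ((hout _).false e).elim

/-- If a vertex `ω` has no outgoing edges (e.g. an observation vertex, Def. 3.5 (iii) (b)), the only
path `ω ⟶ ω` is the empty one (bookkeeping). [cite: MochizukiAbsTopIII2015, Definition 3.5 (iii) p.75] -/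
theorem path_eq_nil_of_isEmpty_hom {V : Type*} [Quiver V] {ω : V} (hout : ∀ b : V, IsEmpty (ω ⟶ b))
    (r : Path ω ω) : r = Path.nil := by
  cases r with
  | nil => rfl
  | cons r e =>
    obtain rfl := eq_of_path_of_isEmpty_hom hout r
    exact ((hout _).false e).elim

/-! ### The saturation is the least saturated set -/

/-- The saturation of `E₀` is contained in every saturated set containing `E₀` (§0: "the smallest
saturated subset … that contains `E`"). [cite: MochizukiAbsTopIII2015, Section 0 p.27] -/
theorem Saturation.subset {V : Type w} [Quiver.{v} V]
    {E₀ E : ∀ ⦃a b : V⦄, Path a b → Path a b → Prop} (hE : IsSaturated E)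
    (h₀ : ∀ ⦃a b : V⦄ ⦃p q : Path a b⦄, E₀ p q → E p q) :
    ∀ ⦃a b : V⦄ ⦃p q : Path a b⦄, Saturation E₀ p q → E p q := by
  intro a b p q h
  induction h with
  | base h => exact h₀ h
  | refl_left _ ih => exact hE.refl_left ih
  | refl_right _ ih => exact hE.refl_right ih
  | trans _ _ ih₁ ih₂ => exact hE.trans ih₁ ih₂
  | precomp r _ ih => exact hE.precomp ih r
  | postcomp r _ ih => exact hE.postcomp ih r

namespace DiagramOfCategories

variable {V : Type w} [Quiver.{v} V] {D : DiagramOfCategories.{v, u, w} V}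

/-! ### Restriction of a family of homotopies to a saturated part of its boundary set -/

/-- **Restriction of a family of homotopies** to a saturated subset `E'` of its boundary set: same
homotopies, smaller boundary set (e.g. the family GENERATED by given pairs inside a bigger family,
Def. 3.5 (ii), or the restriction `𝒥|` of Def. 3.5 (iv) (b)). [cite: MochizukiAbsTopIII2015, Definition 3.5 (ii) p.75] -/
def HomotopyFamily.restrictBoundary (H : D.HomotopyFamily)
    (E' : ∀ ⦃a b : V⦄, Path a b → Path a b → Prop) (hE' : IsSaturated E')
    (hsub : ∀ ⦃a b : V⦄ ⦃p q : Path a b⦄, E' p q → H.E p q) : D.HomotopyFamily where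
  E := E'
  isSaturated := hE'
  η := fun _ _ _ _ h => H.η (hsub h)
  η_refl := fun _ _ _ h => H.η_refl (hsub h)
  η_trans := fun _ _ _ _ _ h₁ h₂ => H.η_trans (hsub h₁) (hsub h₂)
  η_whisker := fun _ _ _ _ _ _ h r₁ r₂ => H.η_whisker (hsub h) r₁ r₂

/-- The restrictions of one family to saturated subsets of its boundary set are compatible (Def. 3.5
(ii): witnessed by the family itself). [cite: MochizukiAbsTopIII2015, Definition 3.5 (ii) p.75] -/
theorem HomotopyFamily.compatible_restrictBoundary (H : D.HomotopyFamily) {ι : Type*}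
    (E' : ι → ∀ ⦃a b : V⦄, Path a b → Path a b → Prop) (hE' : ∀ i, IsSaturated (E' i))
    (hsub : ∀ i, ∀ ⦃a b : V⦄ ⦃p q : Path a b⦄, E' i p q → H.E p q) :
    HomotopyFamily.Compatible D (fun i => H.restrictBoundary (E' i) (hE' i) (hsub i)) :=
  ⟨H, fun i => ⟨hsub i, fun _ _ _ _ _ => rfl⟩⟩

/-! ### Homotopies through a fully faithful structure functor -/

section Lift

variable {A A' B B' C : Type u} [Category.{v} A] [Category.{v} A'] [Category.{v} B]
  [Category.{v} B'] [Category.{v} C] {N : B ⥤ C} (hN : N.FullyFaithful)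

/-- For functors `F, G : A ⥤ B` identified with `M` after composing with a FULLY FAITHFUL `N : B ⥤ C`
(`i : F ⋙ N ≅ M`, `j : G ⋙ N ≅ M`), the unique natural transformation `F ⟶ G` lying over
`i ∘ j⁻¹` (generalises `coreHom'` of `DiagramCores`, the case `N ≅ 𝟭`). [folklore] -/
noncomputable def liftThrough (F G : A ⥤ B) {M : A ⥤ C} (i : F ⋙ N ≅ M) (j : G ⋙ N ≅ M) : F ⟶ G :=
  (hN.whiskeringRight A).preimage (i.hom ≫ j.inv)

/-- `liftThrough` lies over `i ∘ j⁻¹`. [folklore] -/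
private theorem whiskerRight_liftThrough_eq (F G : A ⥤ B) {M : A ⥤ C} (i : F ⋙ N ≅ M) (j : G ⋙ N ≅ M) :
    Functor.whiskerRight (liftThrough hN F G i j) N = i.hom ≫ j.inv :=
  (hN.whiskeringRight A).map_preimage (i.hom ≫ j.inv)

/-- `liftThrough` lies over `i ∘ j⁻¹`, componentwise. [folklore] -/
private theorem map_liftThrough_app (F G : A ⥤ B) {M : A ⥤ C} (i : F ⋙ N ≅ M) (j : G ⋙ N ≅ M) (x : A) :
    N.map ((liftThrough hN F G i j).app x) = i.hom.app x ≫ j.inv.app x :=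
  NatTrans.congr_app (whiskerRight_liftThrough_eq hN F G i j) x

/-- Uniqueness: a natural transformation lying over `i ∘ j⁻¹` IS `liftThrough`. [folklore] -/
private theorem liftThrough_ext {F G : A ⥤ B} {M : A ⥤ C} (i : F ⋙ N ≅ M) (j : G ⋙ N ≅ M) (θ : F ⟶ G)
    (hθ : Functor.whiskerRight θ N = i.hom ≫ j.inv) : θ = liftThrough hN F G i j :=
  (hN.whiskeringRight A).map_injective (hθ.trans (whiskerRight_liftThrough_eq hN F G i j).symm)

/-- Uniqueness, componentwise form. [folklore] -/
private theorem liftThrough_ext_app {F G : A ⥤ B} {M : A ⥤ C} (i : F ⋙ N ≅ M) (j : G ⋙ N ≅ M) (θ : F ⟶ G)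
    (hθ : ∀ x, N.map (θ.app x) = i.hom.app x ≫ j.inv.app x) : θ = liftThrough hN F G i j :=
  liftThrough_ext hN i j θ (NatTrans.ext (funext hθ))

/-- `liftThrough` of a functor with itself is the identity. [folklore] -/
private theorem liftThrough_self (F : A ⥤ B) {M : A ⥤ C} (i : F ⋙ N ≅ M) : liftThrough hN F F i i = 𝟙 F :=
  (liftThrough_ext hN i i (𝟙 F) (by rw [Functor.whiskerRight_id', Iso.hom_inv_id])).symm

/-- `liftThrough` is transitive. [folklore] -/
private theorem liftThrough_trans (F G H : A ⥤ B) {M : A ⥤ C} (i : F ⋙ N ≅ M) (j : G ⋙ N ≅ M)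
    (k : H ⋙ N ≅ M) :
    liftThrough hN F G i j ≫ liftThrough hN G H j k = liftThrough hN F H i k :=
  liftThrough_ext hN i k _ (by
    rw [Functor.whiskerRight_comp, whiskerRight_liftThrough_eq, whiskerRight_liftThrough_eq,
      Category.assoc, Iso.inv_hom_id_assoc])

/-- `liftThrough` does not see a common post-composed isomorphism. [folklore] -/
private theorem liftThrough_postcompIso (F G : A ⥤ B) {M M' : A ⥤ C} (i : F ⋙ N ≅ M) (j : G ⋙ N ≅ M)
    (k : M ≅ M') : liftThrough hN F G (i ≪≫ k) (j ≪≫ k) = liftThrough hN F G i j :=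
  (liftThrough_ext hN (i ≪≫ k) (j ≪≫ k) (liftThrough hN F G i j) (by
    rw [whiskerRight_liftThrough_eq, Iso.trans_hom, Iso.trans_inv, Category.assoc,
      Iso.hom_inv_id_assoc])).symm

/-- Whiskering a `liftThrough` on the left. [folklore] -/
private theorem whiskerLeft_liftThrough (R : A' ⥤ A) (F G : A ⥤ B) {M : A ⥤ C} (i : F ⋙ N ≅ M)
    (j : G ⋙ N ≅ M) :
    Functor.whiskerLeft R (liftThrough hN F G i j) =
      liftThrough hN (R ⋙ F) (R ⋙ G) (Functor.isoWhiskerLeft R i) (Functor.isoWhiskerLeft R j) :=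
  liftThrough_ext hN _ _ _ (by
    ext x
    exact NatTrans.congr_app (whiskerRight_liftThrough_eq hN F G i j) (R.obj x))

/-- Whiskering a `liftThrough` on the RIGHT by a functor `T` that itself lies over `𝒞`
(`I : T ⋙ N' ≅ N`, `N'` fully faithful): the result is the `liftThrough` through `N'`. [folklore] -/
private theorem whiskerRight_liftThrough {N' : B' ⥤ C} (hN' : N'.FullyFaithful) (T : B ⥤ B') (I : T ⋙ N' ≅ N)
    (F G : A ⥤ B) {M : A ⥤ C} (i : F ⋙ N ≅ M) (j : G ⋙ N ≅ M) :
    Functor.whiskerRight (liftThrough hN F G i j) T =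
      liftThrough hN' (F ⋙ T) (G ⋙ T) (Functor.isoWhiskerLeft F I ≪≫ i)
        (Functor.isoWhiskerLeft G I ≪≫ j) :=
  liftThrough_ext hN' _ _ _ (by
    ext x
    have hx := map_liftThrough_app hN F G i j x
    have h2 := NatIso.naturality_2 I ((liftThrough hN F G i j).app x)
    simp only [Functor.comp_map] at h2
    simp only [Functor.whiskerRight_app, Iso.trans_hom, Iso.trans_inv, NatTrans.comp_app,
      Functor.isoWhiskerLeft_hom, Functor.isoWhiskerLeft_inv, Functor.whiskerLeft_app,
      Category.assoc]
    refine h2.symm.trans ?_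
    rw [hx]
    erw [Category.assoc]
    rfl)

/-- `liftThrough` respects (heterogeneous) equality of its inputs (bookkeeping used to compare the
homotopies of a telecore family with those of the core along `𝒥|_𝒮 = ℋ`, Def. 3.5 (iv) (b)).
[cite: MochizukiAbsTopIII2015, Definition 3.5 (iv) p.76] -/
theorem liftThrough_congr {F F' G G' : A ⥤ B} {M : A ⥤ C} (hF : F = F') (hG : G = G')
    {i : F ⋙ N ≅ M} {i' : F' ⋙ N ≅ M} {j : G ⋙ N ≅ M} {j' : G' ⋙ N ≅ M} (hi : i ≍ i')
    (hj : j ≍ j') : liftThrough hN F G i j ≍ liftThrough hN F' G' i' j' := by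
  subst hF hG
  cases hi
  cases hj
  rfl

omit hN in
/-- Absorbing an `eqToIso` prefix into a heterogeneous equality. [folklore] -/
private theorem heq_eqToIso_trans {X X' Y : A ⥤ C} (h : X = X') (e : X' ≅ Y) : (eqToIso h ≪≫ e) ≍ e := by
  subst h
  simp

end Lift

/-! ### Lifts along paths into a vertex with fully faithful structure functor -/

namespace OverData

variable {C : Type u} [Category.{v} C] (O : D.OverData C)

/-- Components of `pathIso` on the empty path (`𝒟_[γ]` for the length-zero path is the identity,
Def. 3.5 (i)). [cite: MochizukiAbsTopIII2015, Definition 3.5 (i) p.75] -/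
theorem pathIso_nil_app (a : V) (x : D.obj a) :
    (O.pathIso (Path.nil : Path a a)).hom.app x = eqToHom (by rw [pathFunctor_nil]; rfl) := by
  rw [pathIso]
  simp only [eqToIso.hom, eqToHom_app]

/-- Components of `pathIso` on an extended path (`𝒟_[γ]` "by composing the various functors `𝒟_e`",
Def. 3.5 (i)). [cite: MochizukiAbsTopIII2015, Definition 3.5 (i) p.75] -/
theorem pathIso_cons_app {a b c : V} (p : Path a b) (e : b ⟶ c) (x : D.obj a) :
    (O.pathIso (p.cons e)).hom.app x =
      eqToHom (by rw [pathFunctor_cons]; rfl) ≫ (O.μ e).hom.app ((D.pathFunctor p).obj x) ≫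
        (O.pathIso p).hom.app x := by
  rw [pathIso]
  simp only [Iso.trans_hom, eqToIso.hom, NatTrans.comp_app, eqToHom_app,
    Functor.isoWhiskerLeft_hom, Functor.whiskerLeft_app]
  rfl

/-- Transport of the components of `μ_e` along an equality of objects. [folklore] -/
private theorem μ_app_congr {b c : V} (e : b ⟶ c) {y y' : D.obj b} (hy : y = y') :
    (O.μ e).hom.app y = eqToHom (by rw [hy]) ≫ (O.μ e).hom.app y' ≫ eqToHom (by rw [hy]) := by
  subst hy
  simp

/-- `pathIso` along a composite path `[γ₂] ∘ [γ₁]`, componentwise (`𝒟_[γ₂∘γ₁] = 𝒟_[γ₂] ∘ 𝒟_[γ₁]`,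
Def. 3.5 (i)). [cite: MochizukiAbsTopIII2015, Definition 3.5 (i) p.75] -/
theorem pathIso_comp_app {a b c : V} (r : Path a b) (p : Path b c) (x : D.obj a) :
    (O.pathIso (r.comp p)).hom.app x =
      eqToHom (by rw [pathFunctor_comp]; rfl) ≫ (O.pathIso p).hom.app ((D.pathFunctor r).obj x) ≫
        (O.pathIso r).hom.app x := by
  induction p with
  | nil =>
    simp only [Path.comp_nil, pathIso_nil_app, eqToHom_trans_assoc]
    erw [eqToHom_refl, Category.id_comp]
  | cons p e ih =>
    simp only [Path.comp_cons, pathIso_cons_app, ih, Category.assoc]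
    rw [O.μ_app_congr e
      (show (D.pathFunctor (r.comp p)).obj x = (D.pathFunctor p).obj ((D.pathFunctor r).obj x) by
        rw [pathFunctor_comp]; rfl)]
    simp only [Category.assoc, eqToHom_trans_assoc]
    congr 2
    erw [eqToHom_trans_assoc, eqToHom_refl, Category.id_comp]
    rfl

/-- `pathIso` along a composite path: `pathIso (γ ∘ ρ) = pathIso ρ ∘ (𝒟_[ρ] ◁ pathIso γ)` up to the
`eqToIso` of `pathFunctor_comp` (Def. 3.5 (i): `𝒟_[γ∘ρ] = 𝒟_[γ] ∘ 𝒟_[ρ]`).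
[cite: MochizukiAbsTopIII2015, Definition 3.5 (i) p.75] -/
theorem pathIso_comp_eq {a b c : V} (r : Path a b) (p : Path b c) :
    O.pathIso (r.comp p) =
      eqToIso (show D.pathFunctor (r.comp p) ⋙ O.N c = D.pathFunctor r ⋙ (D.pathFunctor p ⋙ O.N c) by
          rw [pathFunctor_comp]; rfl) ≪≫
        Functor.isoWhiskerLeft (D.pathFunctor r) (O.pathIso p) ≪≫ O.pathIso r := by
  ext x
  rw [pathIso_comp_app]
  simp only [Iso.trans_hom, eqToIso.hom, NatTrans.comp_app, eqToHom_app, Functor.isoWhiskerLeft_hom,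
    Functor.whiskerLeft_app]
  rfl

variable {a c w w' : V}

/-- **The homotopy of a co-verticial pair into a vertex with fully faithful structure functor**:
for `[γ₁], [γ₂] : a ⟶ w`, the unique `𝒟_[γ₁] ⟶ 𝒟_[γ₂]` lying over `pathIso γ₁ ∘ pathIso γ₂⁻¹`
(Rmk. 3.5.1: the structure functors exhibit the "constant portion" under the diagram).
[cite: MochizukiAbsTopIII2015, Remark 3.5.1 p.78] -/
noncomputable def lift (hw : (O.N w).FullyFaithful) (p q : Path a w) :
    D.pathFunctor p ⟶ D.pathFunctor q :=
  liftThrough hw (D.pathFunctor p) (D.pathFunctor q) (O.pathIso p) (O.pathIso q)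

/-- `lift` lies over `pathIso γ₁ ∘ pathIso γ₂⁻¹`, componentwise (the defining property of the
homotopy `ζ_ϖ`, Def. 3.5 (ii) (b), through the structure functor).
[cite: MochizukiAbsTopIII2015, Definition 3.5 (ii) p.75] -/
theorem map_lift_app (hw : (O.N w).FullyFaithful) (p q : Path a w) (x : D.obj a) :
    (O.N w).map ((O.lift hw p q).app x) = (O.pathIso p).hom.app x ≫ (O.pathIso q).inv.app x :=
  map_liftThrough_app hw _ _ _ _ x

/-- Uniqueness of `lift`: a natural transformation `𝒟_[γ₁] ⟶ 𝒟_[γ₂]` lying over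
`pathIso γ₁ ∘ pathIso γ₂⁻¹` is the lift (faithfulness of the structure functor; Def. 3.5 (ii)).
[cite: MochizukiAbsTopIII2015, Definition 3.5 (ii) p.75] -/
theorem lift_ext (hw : (O.N w).FullyFaithful) {p q : Path a w} (θ : D.pathFunctor p ⟶ D.pathFunctor q)
    (hθ : ∀ x, (O.N w).map (θ.app x) = (O.pathIso p).hom.app x ≫ (O.pathIso q).inv.app x) :
    θ = O.lift hw p q :=
  liftThrough_ext_app hw _ _ θ hθ

/-- Axiom "`ζ_{([γ],[γ])}` is the identity" of Def. 3.5 (ii) for the lifts.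
[cite: MochizukiAbsTopIII2015, Definition 3.5 (ii) p.75] -/
theorem lift_self (hw : (O.N w).FullyFaithful) (p : Path a w) : O.lift hw p p = 𝟙 _ :=
  liftThrough_self hw _ _

/-- Axiom "`ζ_{ϖ''} = ζ_{ϖ'} ∘ ζ_ϖ`" of Def. 3.5 (ii) for the lifts.
[cite: MochizukiAbsTopIII2015, Definition 3.5 (ii) p.75] -/
theorem lift_trans (hw : (O.N w).FullyFaithful) (p q r : Path a w) :
    O.lift hw p q ≫ O.lift hw q r = O.lift hw p r :=
  liftThrough_trans hw _ _ _ _ _ _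

/-- Pre-composition half of the whiskering axiom of Def. 3.5 (ii) for the lifts:
`lift (γ₁∘ρ) (γ₂∘ρ) = 𝒟_[ρ] ◁ lift γ₁ γ₂`, heterogeneously (the two sides live over `𝒟_[γ∘ρ]` and
`𝒟_[ρ] ⋙ 𝒟_[γ]`). [cite: MochizukiAbsTopIII2015, Definition 3.5 (ii) p.75] -/
theorem lift_precomp_heq (hw : (O.N w).FullyFaithful) (r : Path c a) (p q : Path a w) :
    O.lift hw (r.comp p) (r.comp q) ≍ Functor.whiskerLeft (D.pathFunctor r) (O.lift hw p q) := by
  rw [lift, lift, whiskerLeft_liftThrough, O.pathIso_comp_eq r p, O.pathIso_comp_eq r q]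
  refine HEq.trans ?_ (heq_of_eq (liftThrough_postcompIso hw
    (D.pathFunctor r ⋙ D.pathFunctor p) (D.pathFunctor r ⋙ D.pathFunctor q)
    (Functor.isoWhiskerLeft (D.pathFunctor r) (O.pathIso p))
    (Functor.isoWhiskerLeft (D.pathFunctor r) (O.pathIso q)) (O.pathIso r)))
  exact liftThrough_congr hw (by rw [pathFunctor_comp]) (by rw [pathFunctor_comp])
    (heq_eqToIso_trans _ _) (heq_eqToIso_trans _ _)

/-- Post-composition half of the whiskering axiom of Def. 3.5 (ii) for the lifts: for
`[τ] : w ⟶ w'` between vertices with fully faithful structure functors,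
`lift (τ∘γ₁) (τ∘γ₂) = lift γ₁ γ₂ ▷ 𝒟_[τ]`, heterogeneously. [cite: MochizukiAbsTopIII2015, Definition 3.5 (ii) p.75] -/
theorem lift_postcomp_heq (hw : (O.N w).FullyFaithful) (hw' : (O.N w').FullyFaithful)
    (p q : Path a w) (t : Path w w') :
    O.lift hw' (p.comp t) (q.comp t) ≍ Functor.whiskerRight (O.lift hw p q) (D.pathFunctor t) := by
  rw [lift, lift, whiskerRight_liftThrough hw hw' (D.pathFunctor t) (O.pathIso t),
    O.pathIso_comp_eq p t, O.pathIso_comp_eq q t]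
  exact liftThrough_congr hw' (by rw [pathFunctor_comp]) (by rw [pathFunctor_comp])
    (heq_eqToIso_trans _ _) (heq_eqToIso_trans _ _)

end OverData

end DiagramOfCategories

end Literature.AnabelianGeometry.AbsoluteAnabelian
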